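import Literature.NumberTheory.BostConnes.FiniteLevels
import Literature.NumberTheory.BostConnes.KMSGramFiniteLevels
import HarnessLib

/-!
# Bost–Connes system: the symmetries `(ℤ/nℤ)^×` preserve the KMS_β forms on the finite levels

The group `Ẑ^* = GL₁(Ẑ)` acts on the Bost–Connes system by automorphisms commuting with the
time evolution, `θ_g(μ_n) = μ_n`, `θ_g(e(r)) = e(g r)` ([ConnesMarcolli2008] Ch. 3, eq. (3.75);
Thm. 3.32: "The group `GL₁(Ẑ)` acts by automorphisms of the system `(A₁, σ_t)`"). For
`0 < β ≤ 1` the KMS_β state is UNIQUE ([ConnesMarcolli2008] Thm. 3.32, first bullet: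
"`E_β` is a singleton for all `0 < β ≤ 1`"), hence invariant under every `θ_g`; on the values
(3.138) this invariance is the fact that `φ_β(e(r))` depends only on the order of `r`, which
`r ↦ g r` (`g` a unit) preserves. On the finite level `A_n = ℚ[ℤ/nℤ]` the symmetry `g` with
`gcd(g, n) = 1` acts by the (permutation) matrix `σ_g` of
`Literature.NumberTheory.BostConnes.sigmaMatrix` ([ConnesConsaniMarcolli2009] Prop. 2.1 (d):
`σ_k(e(r)) = e(kr)`; for `k` prime to `n` this is the automorphism `θ_k` of (3.75) on the level),
and the invariance reads, for the Gram matrix `G_β = kmsGram β n` of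
`Literature/NumberTheory/BostConnes/KMSGramFiniteLevels.lean`:

  `σ_gᵀ G_β σ_g = G_β`   (`kmsGram_conj_sigmaMatrix_of_coprime`),

i.e. `⟨σ_g x, σ_g y⟩_β = ⟨x, y⟩_β` — the exact operator/pairing coupling identity of the
finite levels of the BC endomotive. (For `k` NOT prime to `n`, `σ_k` is not injective on
`ℤ/nℤ` and no such identity holds; nothing is claimed.) No named facts are introduced.

## Sources (read at the page)

* [ConnesMarcolli2008] A. Connes, M. Marcolli, *Noncommutative Geometry, Quantum Fields and
  Motives*, AMS Colloq. Publ. 55 (2008): Ch. 3 eq. (3.75) p. 461 (symmetries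
  `g ∈ Ẑ^*: g μ_n = μ_n, g e(r) = e(g r)`), Thm. 3.32 pp. 474–475 (uniqueness for `0 < β ≤ 1`;
  `GL₁(Ẑ)` acts by automorphisms), eq. (3.138).
* [ConnesConsaniMarcolli2009] A. Connes, C. Consani, M. Marcolli, *Fun with 𝔽₁*, JNT 129 (2009),
  Prop. 2.1 (d).
-/

noncomputable section

open scoped Matrix

namespace Literature.NumberTheory.BostConnes

variable {n : ℕ}

/-- Multiplication by a unit of `ℤ/nℤ` preserves additive orders: for `gcd(k, n) = 1`,
`ord(k γ) = ord(γ)` in `ℤ/nℤ`. [folklore] -/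
private theorem addOrderOf_mul_of_coprime {k : ℕ} (hk : k.Coprime n) (z : ZMod n) :
    addOrderOf ((k : ZMod n) * z) = addOrderOf z := by
  have hu : IsUnit (k : ZMod n) := (ZMod.isUnit_iff_coprime k n).2 hk
  have hinj : Function.Injective (AddMonoidHom.mulLeft (k : ZMod n)) := by
    intro a b hab
    simpa [AddMonoidHom.mulLeft] using hu.mul_left_cancel hab
  exact addOrderOf_injective (AddMonoidHom.mulLeft (k : ZMod n)) hinj z

/-- Entries of `σ_kᵀ G σ_k`: `(σ_kᵀ G_β σ_k)[i, j] = G_β[k i, k j]` (each column of `σ_k` is a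
single basis vector). [folklore] -/
private theorem sigmaMatrix_transpose_mul_kmsGram_mul_sigmaMatrix_apply [NeZero n] (β : ℝ)
    (k : ℕ) (i j : ZMod n) :
    ((sigmaMatrix ℝ n k)ᵀ * kmsGram β n * sigmaMatrix ℝ n k) i j =
      kmsGram β n ((k : ZMod n) * i) ((k : ZMod n) * j) := by
  have h1 : ∀ c, ((sigmaMatrix ℝ n k)ᵀ * kmsGram β n) i c = kmsGram β n ((k : ZMod n) * i) c := by
    intro c
    rw [Matrix.mul_apply]
    simp only [Matrix.transpose_apply, sigmaMatrix_apply, ite_mul, one_mul, zero_mul]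
    rw [Finset.sum_ite_eq' Finset.univ ((k : ZMod n) * i) (fun a => kmsGram β n a c)]
    simp
  rw [Matrix.mul_apply]
  simp only [h1, sigmaMatrix_apply, mul_ite, mul_one, mul_zero]
  rw [Finset.sum_ite_eq' Finset.univ ((k : ZMod n) * j)
    (fun b => kmsGram β n ((k : ZMod n) * i) b)]
  simp

/-- **The symmetries preserve the KMS_β forms on every finite level.** For `n ≥ 1`, any real
`β`, and `k` prime to `n`, the matrix `σ_k` of the level-`n` symmetry `e(γ) ↦ e(kγ)`
([ConnesMarcolli2008] (3.75); [ConnesConsaniMarcolli2009] Prop. 2.1 (d)) satisfies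
`σ_kᵀ G_β σ_k = G_β` for the KMS_β Gram matrix `G_β[i, j] = φ_β(e((j-i)/n))` of (3.138) —
the finite-level form of the invariance of the unique KMS_β state (`0 < β ≤ 1`) under the
automorphisms `θ_g`, `g ∈ Ẑ^*` ([ConnesMarcolli2008] Thm. 3.32); at the level of the formula it
holds for every real `β` because (3.138) depends only on the order of `r` and units preserve
orders. [cite: ConnesMarcolli2008, Ch. 3 Thm. 3.32 with eq. (3.75) and (3.138)] -/
theorem kmsGram_conj_sigmaMatrix_of_coprime [NeZero n] (β : ℝ) {k : ℕ} (hk : k.Coprime n) :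
    (sigmaMatrix ℝ n k)ᵀ * kmsGram β n * sigmaMatrix ℝ n k = kmsGram β n := by
  ext i j
  rw [sigmaMatrix_transpose_mul_kmsGram_mul_sigmaMatrix_apply, kmsGram_apply, kmsGram_apply,
    ← mul_sub, addOrderOf_mul_of_coprime hk]

/-- Equivalently, entrywise: `G_β[k i, k j] = G_β[i, j]` for `k` prime to `n` (the values
`φ_β(e(γ))` are constant on the orbits of `(ℤ/nℤ)^×`). [cite: ConnesMarcolli2008, Ch. 3 Thm. 3.32 with eq. (3.75) and (3.138)] -/
theorem kmsGram_apply_mul_of_coprime (β : ℝ) {k : ℕ} (hk : k.Coprime n) (i j : ZMod n) :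
    kmsGram β n ((k : ZMod n) * i) ((k : ZMod n) * j) = kmsGram β n i j := by
  rw [kmsGram_apply, kmsGram_apply, ← mul_sub, addOrderOf_mul_of_coprime hk]

end Literature.NumberTheory.BostConnes
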